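import Literature.Probability.LatticeModels.EdgeKilledBeurling
import HarnessLib

/-!
# Lattice-unit outward weak Beurling for killed-harmonic functions (line `symplectic-fermion-anchor`,
crux `SAWLoopFugacityFlow.AvoidanceLimit`, stmt-CriticalPhenomena-10649)

The all-scales OUTWARD weak Beurling estimate (Chelkak 2016, Lemma 2.13; Smirnov 2010, Lemma B.2)
for nonnegative functions `h` that are harmonic for the EDGE-killed walk
`Gr = discreteDomainGraph D δ` of a Jordan domain `D` on `Λ ∩ W`, `W := mW c (5^J k)` the box of
radius `48·5^J k` about `c`, and vanish off the finite region `Λ`: if a boundary point `p ∈ ∂D`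
lies in the open `12k`-box about `c` (read on `δℤ²`) and `h ≤ M` on `Λ ∖ W`, then on the start
box `mB c k`

  `h ≤ (1 - c_*)^(J+1) · M`,   `c_* = maneuverConst`.

* `killedHarmonic_le_pow_mul_of_frontier` — comparison of `h` with `M · edgeSurvive Gr W`
  (killed-harmonic on `W ⊇ Λ ∩ W`, `= M` off `W`, `≥ 0`) on `Λ ∩ W` by the comparison principle of
  `KilledWalkLaplacian.lean`, then the tree's multi-scale maneuver
  `JordanDomain.edgeKilled_survive_le_pow` (`EdgeKilledBeurling.lean`) on `mB c k`.

It is the decay input for Green functions `G_Λ(·,u)` (`u ∉ W`) and exit kernels at the landing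
points of the walls in the line's hub factorisation. Everything is proved; no definitions.
Source: D. Chelkak, *Robust discrete complex analysis: a toolbox*, Ann. Probab. 44 (2016),
Lemma 2.13 [Chelkak2016]; S. Smirnov, *Conformal invariance in random cluster models. I*,
Ann. of Math. 172 (2010), Lemma B.2 [Smirnov2010].
-/

noncomputable section

open scoped BigOperators Classical
open Finset
open Literature.Probability.RandomPlanarGeometry Literature.Probability.LatticeModels

namespace Summit.CriticalPhenomena.SAWScalingLimit.Theorems.AvoidanceLimit.Anchor

/-- The maneuver boxes are nested along the scales `k ≤ 5^J k`: `mW c k ⊆ mW c (5^J k)`. [folklore] -/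
theorem mW_subset_mW_five_pow (c : Site 2) (k J : ℕ) : mW c k ⊆ mW c (5 ^ J * k) := by
  have hk : (k : ℤ) ≤ ((5 ^ J * k : ℕ) : ℤ) := by
    exact_mod_cast Nat.le_mul_of_pos_left k (pow_pos (by norm_num) J)
  rintro w ⟨h0, h1⟩
  exact ⟨h0.trans (by linarith), h1.trans (by linarith)⟩

/-- **Lattice-unit outward weak Beurling for killed-harmonic functions.** Let `D` be a Jordan
domain, `δ > 0`, `p ∈ ∂D` a boundary point in the open box of radius `12k` about `c` on `δℤ²`,
`W := mW c (5^J k)`, `Λ` a finite region and `h ≥ 0` a function vanishing off `Λ` which is harmonic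
for the edge-killed walk `discreteDomainGraph D δ` on `Λ ∩ W`. If `h ≤ M` (`M ≥ 0`) on `Λ ∖ W`, then
`h z ≤ (1 - maneuverConst)^(J+1) · M` for every `z ∈ mB c k`. Proof: on `Λ ∩ W`, `h ≤ M · edgeSurvive W`
by the comparison principle (the right side is killed-harmonic on `W`, equals `M` off `W` and is
nonnegative, while off `Λ` the left side vanishes); on `mB c k ⊆ W` the survival probability is at most
`(1 - c_*)^(J+1)` by the multi-scale maneuver `JordanDomain.edgeKilled_survive_le_pow`.
[cite: Chelkak2016, Lemma 2.13] -/
theorem killedHarmonic_le_pow_mul_of_frontier :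
    ∀ (D : JordanDomain) (δ : ℝ), 0 < δ → ∀ p ∈ frontier D.carrier, ∀ (c : Site 2) (k J : ℕ), 0 < k →
      |p.re / δ - c 0| < 12 * k → |p.im / δ - c 1| < 12 * k →
      ∀ (Λ : Set (Site 2)), Λ.Finite → ∀ (h : Site 2 → ℝ), (∀ w, 0 ≤ h w) → (∀ w, w ∉ Λ → h w = 0) →
      IsKilledHarmonicOn (discreteDomainGraph D.carrier δ) h (Λ ∩ mW c (5 ^ J * k)) →
      ∀ (M : ℝ), 0 ≤ M → (∀ w ∈ Λ, w ∉ mW c (5 ^ J * k) → h w ≤ M) →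
      ∀ z ∈ mB c k, h z ≤ (1 - maneuverConst) ^ (J + 1) * M := by
  intro D δ hδ p hp c k J hk hp0 hp1 Λ hΛ h h0 hoff hharm M hM0 hM z hz
  set Gr := discreteDomainGraph D.carrier δ
  set W : Set (Site 2) := mW c (5 ^ J * k)
  have hWfin : W.Finite := mW_finite c _
  have hSfin : (Λ ∩ W).Finite := hΛ.subset Set.inter_subset_left
  have hpow0 : 0 ≤ (1 - maneuverConst) ^ (J + 1) := pow_nonneg (by linarith [maneuverConst_le_one]) _
  by_cases hzΛ : z ∈ Λ
  · -- `z ∈ Λ ∩ W`: compare `h` with `M · edgeSurvive W` on `Λ ∩ W`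
    have hzW : z ∈ W := mW_subset_mW_five_pow c k J (mB_subset_mW hz)
    have h2 : IsKilledHarmonicOn Gr (fun w => M * edgeSurvive Gr W w) (Λ ∩ W) :=
      ((killedHarmExt_harmonicOn hWfin _).const_mul M).mono Set.inter_subset_right
    have hb : ∀ w ∈ killedOuterBoundary Gr (Λ ∩ W), h w ≤ M * edgeSurvive Gr W w := by
      intro w hw
      have hwS : w ∉ Λ ∩ W := hw.1
      by_cases hwΛ : w ∈ Λ
      · have hwW : w ∉ W := fun h' => hwS ⟨hwΛ, h'⟩
        rw [edgeSurvive_of_not_mem hwW, mul_one]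
        exact hM w hwΛ hwW
      · rw [hoff w hwΛ]
        exact mul_nonneg hM0 (edgeSurvive_mem_Icc hWfin w).1
    have hcmp := le_of_killedSub_killedSuper_of_boundary hSfin hharm.subharmonicOn h2.superharmonicOn hb
      z ⟨hzΛ, hzW⟩
    have hsurv : edgeSurvive Gr W z ≤ (1 - maneuverConst) ^ (J + 1) :=
      D.edgeKilled_survive_le_pow hδ hp J c k hk hp0 hp1 z hz
    calc h z ≤ M * edgeSurvive Gr W z := hcmp
      _ ≤ M * (1 - maneuverConst) ^ (J + 1) := mul_le_mul_of_nonneg_left hsurv hM0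
      _ = (1 - maneuverConst) ^ (J + 1) * M := mul_comm _ _
  · rw [hoff z hzΛ]
    exact mul_nonneg hpow0 hM0

end Summit.CriticalPhenomena.SAWScalingLimit.Theorems.AvoidanceLimit.Anchor

end
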